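import Mathlib.Tactic
import HarnessLib

/-!
# N2 (frames-only node, OPEN) — (F) column, THE FIVE NODE ROWS OF THE (F) WRAPPER AS PURE ARITHMETIC: `NegB.faceNodeRows_arith` (hp-8 g44)
The tuple-generic (F) wrapper `NegB.faceHoldsRNQFnLTK_frmChoiceAllQ3V_of` keeps FIVE NODE ROWS (`hcapX hwinX hcapY hwinY hwinYx`: cap and window rows
in the contact slack `A∥ := (hF∥+1)/2 + 5(E−1) + 15`) over the face cells `fcellsV … (cOf … cv) (hOf … hv)`.  At the node tuple `(cv, hv, bv) :=
(cR2W 0, hFR 0, small3)` stmt-g22's value kit (2026-08-23T22:11:21Z) reads the cells' numbers as: `hF₀ = c₀ + 5s₁ + 2`, `hF₁ = c₁ + 54s₀ + 2`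
(`hFRv_apply`), creep caps `c₀ ≤ 30s₁ + 1`, `c₁ ≤ 126s₀` (`cR2vW_caps`), windows `bwX = 19s₁ − 6s₁`, `bwY = 76s₀ − 7s₀` (`small3_eq`, `bwX_eq/bwY_eq`),
radii `r_i = 40·Kq·s_i` and `6R′0 + 11 ≤ s_i` (p1's `uA_oth_factsR0`), band `E − 1 ≤ 2R′0 − 3` (`Rlev0 = R′0 − 1`, `reach0 < R′0`).  THIS FILE is the
arithmetic that closes the five rows from those readings, over abstract integers, with the K-floor entering ONLY as **`480·s_i ≤ r_i`** (i.e. `Kq ≥ 12`,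
`K₀ ≥ 440`; the y-cap row `3c₁ + 78s₀ + 10(E−1) + 57 ≤ r₀` is the one that needs it — at `c₁ ≈ 126s₀` it fails for `Kq ≤ 11`).  Mathlib-only; `omega`.
builds on p205010 (kernel theorem, internal audit signed; external expert review pending) — nothing here uses p205010; NOTHING is claimed about the open node
`SamePDropOfSkeletonFrm₁`.
Lane `prim-bschramm`, seat `prim-hp-8` (gen 44); helper file (`--supports stmt-CriticalPhenomena-4575 --as helper`).
[cite: KozmaNitzan2024, §4 Theorem 6 (pp. 25–31): the order of constants] [cite: MartineauTassion2017, §3.2 Lemma 3.5]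
-/

namespace Summit.CriticalPhenomena.PercolationContinuityZ3.Theorems.Transplant

namespace PlanarSkeletonFrm

namespace NegB

/-- **The five node rows of the (F) wrapper from the tuple's readings** (see the module docstring): x-cap, x-window, y-cap, y-window, y′-window-x
(the `C_y = 19` feasibility row), in the wrapper's verbatim shapes with `A∥ := (hF∥ + 1)/2 + (5·e + 15)`, `e := E − 1`. [folklore] -/
theorem faceNodeRows_arith (c₀ c₁ hF₀ hF₁ r₀ r₁ bX bY u₀ u₁ e R' : ℤ)
    (hhF₀ : hF₀ = c₀ + 5 * u₁ + 2) (hhF₁ : hF₁ = c₁ + 54 * u₀ + 2)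
    (hc₀ : 0 ≤ c₀) (hc₀' : c₀ ≤ 30 * u₁ + 1) (hc₁ : 0 ≤ c₁) (hc₁' : c₁ ≤ 126 * u₀)
    (hbX : bX = 19 * u₁ - 6 * u₁) (hbY : bY = 76 * u₀ - 7 * u₀)
    (hr₀ : 480 * u₀ ≤ r₀) (hr₁ : 480 * u₁ ≤ r₁)
    (hu₀ : 6 * R' + 11 ≤ u₀) (hu₁ : 6 * R' + 11 ≤ u₁) (he' : e + 3 ≤ 2 * R') :
    (2 * ((hF₀ + 1) / 2 + (5 * e + 15)) + 8 * u₁ + 8 + 2 * c₀ ≤ r₁) ∧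
      (2 * ((hF₀ + 1) / 2 + (5 * e + 15)) + hF₀ + 6 * u₁ ≤ 2 * c₀ + 2 * bX) ∧
        (2 * ((hF₁ + 1) / 2 + (5 * e + 15)) + 24 * u₀ + 24 + 2 * c₁ ≤ r₀) ∧
          (2 * ((hF₁ + 1) / 2 + (5 * e + 15)) + hF₁ + 14 * u₀ ≤ 2 * c₁ + 2 * bY) ∧
            (2 * ((hF₁ + 1) / 2 + (5 * e + 15)) + hF₁ + 24 * u₀ + 10 ≤ 2 * c₁ + 2 * bY) := by
  subst hhF₀ hhF₁ hbX hbY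
  refine ⟨?_, ?_, ?_, ?_, ?_⟩ <;> omega

/-- **The y-cap row is the binding one**: with `c₁ = 126·u₀`, `e = 0` and `r₀ = 440·u₀` (i.e. `Kq = 11`) it FAILS for every `u₀ ≥ 1` — so the K-floor
`480·u₀ ≤ r₀` (`Kq ≥ 12`) of `faceNodeRows_arith` is needed up to the constant. [folklore] -/
theorem faceNodeRows_ycap_tight (u₀ : ℤ) (hu : 1 ≤ u₀) :
    ¬ (2 * (((126 * u₀ + 54 * u₀ + 2) + 1) / 2 + (5 * (0 : ℤ) + 15)) + 24 * u₀ + 24 + 2 * (126 * u₀) ≤ 440 * u₀) := by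
  omega

end NegB

end PlanarSkeletonFrm

end Summit.CriticalPhenomena.PercolationContinuityZ3.Theorems.Transplant
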